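import Literature.NumberTheory.Sieve.FGKMT2018AdmissibleShifts
import Literature.NumberTheory.Sieve.FGKMT2018SigmaBounds
import Literature.NumberTheory.LFunctions.RHWave0PNTProofs
import HarnessLib

/-!
# Ford–Green–Konyagin–Maynard–Tao 2018 — §6: the parameter regime of the deduction
# Theorem 5 ⟹ Theorem 4 (PROVED numerics: `s₀`, `r = ⌊log^{1/5} x⌋`, `δ`-terms, `σ`, `y`, `|𝒬|`)

Topic `Literature/NumberTheory/Sieve`. Source: K. Ford, B. Green, S. Konyagin, J. Maynard, T. Tao,
*Long gaps between primes*, J. Amer. Math. Soc. 31 (2018) 65–105 = arXiv:1412.5029, §6 pp. 17–19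
[FordGreenKonyaginMaynardTao2018]: «Let `x, c, y, z, 𝒮, 𝒫, 𝒬` be as in Theorem 4. Set `r` to be the
maximum value permitted by Theorem 5, namely (6.1) `r := ⌊log^{1/5} x⌋` … the quantity `σ`
obeys (6.8) `σ ∼ 80 log₂² x/(log x log₃ x)`, (6.9) `σ y = (1 + O(1/log₂^{10} x)) 80 c x log₂ x` …
Lemma 6.1 with `t ≤ s^{1/2}`, `B ≪ x²` for its elements, `log^{20} x < s ≤ z` …».

This file PROVES the elementary numerics of that regime, as used by the engines
`FGKMT2018BoxMoments` (Lemma 6.1: moduli `s ≥ s₀`, `δ_k = k³ log M/(s₀ log s₀)`),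
`FGKMT2018GoodPrimes`, `FGKMT2018CoveringMoments`, `FGKMT2018BadPrimes`:
* `sMin x = ⌊log^{20} x⌋ + 1` and `sMin_le_of_mem` (`s ∈ 𝒮 ⟹ s₀ ≤ s`), `lt_sMin`;
* `shiftCount_pow_three_le`, `two_mul_shiftCount_le_sMin`, `delta_le` (`δ_{2r} ≤ 2/log^{18} x` with
  `M = x³`), `exp_shift_ge` (`e^{-2r² Σ_{s ∈ 𝒮} 1/s²} ≥ 1 − 4/log^{19} x`);
* `inv_log_le_sigma` (`σ ≥ 1/log x`), `log_pow_div_sigma_pow_le` (`(log x/σ)^r ≤ x^{1/100}`);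
* `ySieve_le_sq`, `le_ySieve` (`x ≤ y ≤ x²`), `diam_le_cube` (`2y + 2r²x ≤ x³`, `4r²x ≤ x³`),
  `four_mul_sq_shiftCount_le`;
* `card_primesQ_le` (`|𝒬| ≤ 1.01 y/log x`, from the prime number theorem
  `LFunctions.primeCounting_isEquivalent_holds`), `log_shiftCount_bounds`
  (`log₂ x/10 ≤ log r ≤ log₂ x/5`).
-/

noncomputable section

open Finset Filter Asymptotics

namespace Literature.NumberTheory.Sieve

namespace FGKMT2018

/-! ### The least modulus `s₀` -/

/-- `s₀ := ⌊log^{20} x⌋ + 1`, a lower bound for the moduli `s ∈ 𝒮` («`log^{20} x < s ≤ z`»).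
[cite: FordGreenKonyaginMaynardTao2018, (3.3) and Lemma 6.1 p. 17] -/
def sMin (x : ℕ) : ℕ := ⌊(Real.log x) ^ 20⌋₊ + 1

/-- [cite: FordGreenKonyaginMaynardTao2018, (3.3)] -/
theorem sMin_le_of_mem {x s : ℕ} (hs : s ∈ primesS x) : sMin x ≤ s := by
  have h := (mem_primesS.1 hs).2.1
  have : ⌊(Real.log x) ^ 20⌋₊ < s :=
    (Nat.floor_lt (pow_nonneg (Real.log_natCast_nonneg x) _)).2 h
  unfold sMin
  omega

/-- [cite: FordGreenKonyaginMaynardTao2018, (3.3)] -/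
theorem lt_sMin (x : ℕ) : (Real.log x) ^ 20 < (sMin x : ℝ) := by
  unfold sMin
  push_cast
  exact Nat.lt_floor_add_one _

/-- [cite: FordGreenKonyaginMaynardTao2018, (3.3)] -/
theorem sMin_le (x : ℕ) : (sMin x : ℝ) ≤ (Real.log x) ^ 20 + 1 := by
  unfold sMin
  push_cast
  linarith [Nat.floor_le (pow_nonneg (Real.log_natCast_nonneg x) 20)]

/-- [cite: FordGreenKonyaginMaynardTao2018, (3.3)] -/
theorem prime_of_mem_primesS {x s : ℕ} (hs : s ∈ primesS x) : s.Prime :=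
  (mem_primesS.1 hs).1

/-- `2 ≤ s₀` once `log x ≥ 1`. [cite: FordGreenKonyaginMaynardTao2018, (3.3)] -/
theorem two_le_sMin {x : ℕ} (hL : 1 ≤ Real.log x) : 2 ≤ sMin x := by
  have h1 : (1 : ℝ) ≤ (Real.log x) ^ 20 := one_le_pow₀ hL
  have : 1 ≤ ⌊(Real.log x) ^ 20⌋₊ := Nat.le_floor (by exact_mod_cast h1)
  unfold sMin
  omega

/-- `log s₀ ≥ 20 log₂ x`. [cite: FordGreenKonyaginMaynardTao2018, Lemma 6.1 p. 17] -/
theorem log_sMin_ge {x : ℕ} (hL : 1 ≤ Real.log x) :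
    20 * Real.log (Real.log x) ≤ Real.log (sMin x) := by
  have h : 20 * Real.log (Real.log x) = Real.log ((Real.log x) ^ 20) := by
    rw [Real.log_pow]; norm_num
  rw [h]
  exact Real.log_le_log (pow_pos (by linarith) _) (lt_sMin x).le

/-! ### Powers of `r = ⌊log^{1/5} x⌋` -/

/-- `r³ ≤ log x` (for `log x ≥ 1`). [cite: FordGreenKonyaginMaynardTao2018, (6.1) p. 17] -/
theorem shiftCount_pow_three_le {x : ℕ} (hL : 1 ≤ Real.log x) :
    (shiftCount x : ℝ) ^ 3 ≤ Real.log x := by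
  have h := shiftCount_le x
  have hL0 : 0 ≤ Real.log x := by linarith
  calc (shiftCount x : ℝ) ^ 3 ≤ ((Real.log x) ^ ((1 : ℝ) / 5)) ^ 3 :=
        pow_le_pow_left₀ (Nat.cast_nonneg _) h 3
    _ = (Real.log x) ^ ((3 : ℝ) / 5) := by
        rw [← Real.rpow_natCast, ← Real.rpow_mul hL0]; norm_num
    _ ≤ (Real.log x) ^ (1 : ℝ) := Real.rpow_le_rpow_of_exponent_le hL (by norm_num)
    _ = Real.log x := Real.rpow_one _

/-- `r² ≤ log x` (for `log x ≥ 1`). [cite: FordGreenKonyaginMaynardTao2018, (6.1) p. 17] -/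
theorem shiftCount_sq_le {x : ℕ} (hL : 1 ≤ Real.log x) :
    (shiftCount x : ℝ) ^ 2 ≤ Real.log x := by
  have h := shiftCount_le x
  have hL0 : 0 ≤ Real.log x := by linarith
  calc (shiftCount x : ℝ) ^ 2 ≤ ((Real.log x) ^ ((1 : ℝ) / 5)) ^ 2 :=
        pow_le_pow_left₀ (Nat.cast_nonneg _) h 2
    _ = (Real.log x) ^ ((2 : ℝ) / 5) := by
        rw [← Real.rpow_natCast, ← Real.rpow_mul hL0]; norm_num
    _ ≤ (Real.log x) ^ (1 : ℝ) := Real.rpow_le_rpow_of_exponent_le hL (by norm_num)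
    _ = Real.log x := Real.rpow_one _

/-- `r ≤ log x` (for `log x ≥ 1`). [cite: FordGreenKonyaginMaynardTao2018, (6.1) p. 17] -/
theorem shiftCount_le_log {x : ℕ} (hL : 1 ≤ Real.log x) : (shiftCount x : ℝ) ≤ Real.log x := by
  refine (shiftCount_le x).trans ?_
  calc (Real.log x) ^ ((1 : ℝ) / 5) ≤ (Real.log x) ^ (1 : ℝ) :=
        Real.rpow_le_rpow_of_exponent_le hL (by norm_num)
    _ = Real.log x := Real.rpow_one _

/-- `2r ≤ s₀` (the hypothesis `2 #H ≤ s₀` of the second-moment engines), for `log x ≥ 2`.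
[cite: FordGreenKonyaginMaynardTao2018, Lemma 6.1 p. 17 («`t ≤ s^{1/2}`»)] -/
theorem two_mul_shiftCount_le_sMin {x : ℕ} (hL : 2 ≤ Real.log x) : 2 * shiftCount x ≤ sMin x := by
  have h1 : (shiftCount x : ℝ) ≤ Real.log x := shiftCount_le_log (by linarith)
  have h2 : 2 * Real.log x ≤ (Real.log x) ^ 20 := by
    have : (Real.log x) ^ 20 = Real.log x * (Real.log x) ^ 19 := by ring
    rw [this]
    have h19 : (2 : ℝ) ≤ (Real.log x) ^ 19 :=
      hL.trans (le_self_pow₀ (by linarith) (by norm_num))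
    have := mul_le_mul_of_nonneg_left h19 (show (0 : ℝ) ≤ Real.log x by linarith)
    linarith
  have h3 := lt_sMin x
  have : (2 * shiftCount x : ℝ) < sMin x := by linarith
  exact_mod_cast this.le

/-- **The `δ`-term of Lemma 6.1 in the regime of §6**: with `M = x³`, `k = 2r`:
`(2r)³ log(x³)/(s₀ log s₀) ≤ 2/log^{18} x` (for `log x ≥ 1`, `log₂ x ≥ 1`).
[cite: FordGreenKonyaginMaynardTao2018, Lemma 6.1 p. 17] -/
theorem delta_le {x : ℕ} (hL : 1 ≤ Real.log x) (hL₂ : 1 ≤ Real.log (Real.log x)) :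
    (2 * (shiftCount x : ℝ)) ^ 3 * Real.log ((x : ℝ) ^ 3) / (sMin x * Real.log (sMin x)) ≤
      2 / (Real.log x) ^ 18 := by
  have hL0 : 0 < Real.log x := by linarith
  have hr3 := shiftCount_pow_three_le hL
  have hs := lt_sMin x
  have hlogs := log_sMin_ge hL
  have hspos : (0 : ℝ) < sMin x := lt_of_le_of_lt (pow_nonneg hL0.le _) hs
  have hlogspos : 0 < Real.log (sMin x) := lt_of_lt_of_le (by linarith) hlogs
  have hnum : (2 * (shiftCount x : ℝ)) ^ 3 * Real.log ((x : ℝ) ^ 3) ≤ 24 * (Real.log x) ^ 2 := by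
    rw [Real.log_pow]
    push_cast
    have : (2 * (shiftCount x : ℝ)) ^ 3 = 8 * (shiftCount x : ℝ) ^ 3 := by ring
    rw [this]
    nlinarith
  have hden : 20 * (Real.log x) ^ 20 ≤ (sMin x : ℝ) * Real.log (sMin x) := by
    calc 20 * (Real.log x) ^ 20 ≤ (Real.log x) ^ 20 * (20 * Real.log (Real.log x)) := by
            have := mul_le_mul_of_nonneg_left (show (20 : ℝ) ≤ 20 * Real.log (Real.log x) by
              linarith) (pow_nonneg hL0.le 20)
            linarith
      _ ≤ (sMin x : ℝ) * Real.log (sMin x) :=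
          mul_le_mul hs.le hlogs (by linarith) hspos.le
  rw [div_le_div_iff₀ (mul_pos hspos hlogspos) (pow_pos hL0 18)]
  calc (2 * (shiftCount x : ℝ)) ^ 3 * Real.log ((x : ℝ) ^ 3) * (Real.log x) ^ 18
        ≤ 24 * (Real.log x) ^ 2 * (Real.log x) ^ 18 :=
          mul_le_mul_of_nonneg_right hnum (pow_nonneg hL0.le _)
    _ = (24 / 20) * (20 * (Real.log x) ^ 20) := by ring
    _ ≤ 2 * (20 * (Real.log x) ^ 20) := by
          refine mul_le_mul_of_nonneg_right (by norm_num) (by positivity)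
    _ ≤ 2 * ((sMin x : ℝ) * Real.log (sMin x)) := mul_le_mul_of_nonneg_left hden (by norm_num)

/-- **The lower-bound factor of Lemma 6.1 in the regime of §6**: `2r² Σ_{s ∈ 𝒮} 1/s² ≤ 4/log^{19} x`
and hence `e^{-2r² Σ 1/s²} ≥ 1 − 4/log^{19} x` (for `log x ≥ 1`).
[cite: FordGreenKonyaginMaynardTao2018, Lemma 6.1 p. 17] -/
theorem exp_shift_ge {x : ℕ} (hL : 1 ≤ Real.log x) :
    2 * (shiftCount x : ℝ) ^ 2 * ∑ s ∈ primesS x, 1 / (s : ℝ) ^ 2 ≤ 4 / (Real.log x) ^ 19 ∧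
    1 - 4 / (Real.log x) ^ 19 ≤
      Real.exp (-(2 * (shiftCount x : ℝ) ^ 2 * ∑ s ∈ primesS x, 1 / (s : ℝ) ^ 2)) := by
  have hL0 : 0 < Real.log x := by linarith
  have hsum := sum_primesS_inv_sq_le (x := x) (pow_pos hL0 20)
  have hsum' : ∑ s ∈ primesS x, 1 / (s : ℝ) ^ 2 ≤ 2 / (Real.log x) ^ 20 := by
    refine le_trans (le_of_eq (Finset.sum_congr rfl fun s _ => ?_)) hsum
    rw [one_div_pow]
  have hr2 := shiftCount_sq_le hL
  have h1 : 2 * (shiftCount x : ℝ) ^ 2 * ∑ s ∈ primesS x, 1 / (s : ℝ) ^ 2 ≤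
      4 / (Real.log x) ^ 19 := by
    calc 2 * (shiftCount x : ℝ) ^ 2 * ∑ s ∈ primesS x, 1 / (s : ℝ) ^ 2
          ≤ 2 * Real.log x * (2 / (Real.log x) ^ 20) :=
            mul_le_mul (by linarith) hsum' (Finset.sum_nonneg fun s _ => by positivity)
              (by positivity)
      _ = 4 / (Real.log x) ^ 19 := by field_simp; ring
  refine ⟨h1, ?_⟩
  calc 1 - 4 / (Real.log x) ^ 19 ≤ 1 - 2 * (shiftCount x : ℝ) ^ 2 * ∑ s ∈ primesS x, 1 / (s : ℝ) ^ 2 := by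
        linarith
    _ ≤ Real.exp (-(2 * (shiftCount x : ℝ) ^ 2 * ∑ s ∈ primesS x, 1 / (s : ℝ) ^ 2)) := by
        have := Real.add_one_le_exp (-(2 * (shiftCount x : ℝ) ^ 2 * ∑ s ∈ primesS x, 1 / (s : ℝ) ^ 2))
        linarith

/-- `4r² ≤ x` once `4 log x ≤ x` (so that `|h − h'| ≤ 2r² − 1 < x/2 < p` for `p ∈ 𝒫`: the
cross-prime hypothesis). [cite: FordGreenKonyaginMaynardTao2018, Lemma 6.2 (proof) p. 19] -/
theorem four_mul_sq_shiftCount_le {x : ℕ} (hL : 1 ≤ Real.log x) (hx : 4 * Real.log x ≤ x) :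
    4 * (shiftCount x : ℝ) ^ 2 ≤ x := by
  linarith [shiftCount_sq_le hL]

/-! ### Eventual growth facts and the size of `σ`, `y`, `𝒬` -/

/-- `log^[2] t = log log t`. [folklore] -/
private theorem iter_two (t : ℝ) : Real.log^[2] t = Real.log (Real.log t) := by
  simp [Function.iterate_succ_apply']

/-- `log^[3] t = log log log t`. [folklore] -/
private theorem iter_three (t : ℝ) : Real.log^[3] t = Real.log (Real.log (Real.log t)) := by
  simp [Function.iterate_succ_apply']

/-- The growth facts of the regime `x → ∞` used below.
[cite: FordGreenKonyaginMaynardTao2018, §6 p. 17 («for sufficiently large `x`»)] -/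
theorem params_growth : ∀ᶠ x : ℕ in atTop,
    2 ≤ Real.log x ∧ 1 ≤ Real.log (Real.log x) ∧ 1 ≤ Real.log (Real.log (Real.log x)) ∧
      81 * (Real.log (Real.log x)) ^ 2 ≤ Real.log x ∧ (Real.log x) ^ 2 ≤ x ∧
      200 * ((Real.log x) ^ ((1 : ℝ) / 5) * Real.log (Real.log x)) ≤ Real.log x ∧
      (2 : ℝ) ≤ (Real.log x) ^ ((1 : ℝ) / 5) ∧ 7 ≤ Real.log (Real.log x) := by
  have hℓ : Tendsto (fun x : ℕ => Real.log x) atTop atTop :=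
    Real.tendsto_log_atTop.comp tendsto_natCast_atTop_atTop
  have hℓ₂ : Tendsto (fun x : ℕ => Real.log (Real.log x)) atTop atTop :=
    Real.tendsto_log_atTop.comp hℓ
  have hA : ∀ᶠ x : ℕ in atTop, (Real.log x) ^ 2 ≤ x := by
    have h := ((Real.isLittleO_pow_log_id_atTop (n := 2)).comp_tendsto
      tendsto_natCast_atTop_atTop).bound zero_lt_one
    filter_upwards [h] with x hx
    simpa [Real.norm_eq_abs, abs_of_nonneg (sq_nonneg (Real.log (x : ℝ)))] using hx
  have hB : ∀ᶠ x : ℕ in atTop,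
      200 * ((Real.log x) ^ ((1 : ℝ) / 5) * Real.log (Real.log x)) ≤ Real.log x := by
    have h := (isLittleO_log_rpow_atTop (show (0 : ℝ) < 4 / 5 by norm_num)).bound
      (show (0 : ℝ) < 1 / 200 by norm_num)
    filter_upwards [hℓ.eventually h, hℓ.eventually_ge_atTop 1, hℓ₂.eventually_ge_atTop 0]
      with x hx hL1 hL₂0
    have hL0 : 0 < Real.log x := by linarith
    rw [Real.norm_eq_abs, Real.norm_eq_abs, abs_of_nonneg hL₂0,
      abs_of_nonneg (Real.rpow_nonneg hL0.le _)] at hx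
    have h15 : 0 ≤ (Real.log x) ^ ((1 : ℝ) / 5) := Real.rpow_nonneg hL0.le _
    calc 200 * ((Real.log x) ^ ((1 : ℝ) / 5) * Real.log (Real.log x))
          ≤ 200 * ((Real.log x) ^ ((1 : ℝ) / 5) * (1 / 200 * (Real.log x) ^ ((4 : ℝ) / 5))) :=
            mul_le_mul_of_nonneg_left (mul_le_mul_of_nonneg_left hx h15) (by norm_num)
      _ = (Real.log x) ^ ((1 : ℝ) / 5) * (Real.log x) ^ ((4 : ℝ) / 5) := by ring
      _ = Real.log x := by
            rw [← Real.rpow_add hL0]; norm_num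
  have hC : ∀ᶠ x : ℕ in atTop, (2 : ℝ) ≤ (Real.log x) ^ ((1 : ℝ) / 5) := by
    filter_upwards [hℓ.eventually_ge_atTop 32] with x hx
    have h32 : (32 : ℝ) ^ ((1 : ℝ) / 5) = 2 := by
      rw [show (32 : ℝ) = 2 ^ (5 : ℝ) by norm_num, ← Real.rpow_mul (by norm_num)]
      norm_num
    rw [← h32]
    exact Real.rpow_le_rpow (by norm_num) hx (by norm_num)
  filter_upwards [sigma_growth, hA, hB, hC, hℓ₂.eventually_ge_atTop 7] with x h1 h2 h3 h4 h5
  exact ⟨h1.1, h1.2.1, h1.2.2.1, h1.2.2.2, h2, h3, h4, h5⟩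

/-- **`σ ≥ 1/log x`** (a crude consequence of (6.8) `σ ∼ 80 log₂² x/(log x log₃ x)`).
[cite: FordGreenKonyaginMaynardTao2018, (6.8) p. 17] -/
theorem inv_log_le_sigma : ∀ᶠ x : ℕ in atTop, 1 / Real.log x ≤ sigma x := by
  filter_upwards [sigma_bounds, sigma_growth] with x hσ hg
  obtain ⟨h1, h2, h3, -⟩ := hg
  refine le_trans ?_ hσ.1
  rw [sigmaMain, iter_two, iter_three]
  set L := Real.log x with hLdef
  set L₂ := Real.log L with hL₂def
  set L₃ := Real.log L₂ with hL₃def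
  have hL0 : 0 < L := by linarith
  have hL₂0 : 0 < L₂ := by linarith
  have hL₃0 : 0 < L₃ := by linarith
  have hexp : 1 / 3 ≤ Real.exp (-(1 / L₂)) := by
    have hm : Real.exp (-1) ≤ Real.exp (-(1 / L₂)) := by
      rw [Real.exp_le_exp]
      have : 1 / L₂ ≤ 1 := by rw [div_le_one hL₂0]; exact h2
      linarith
    refine le_trans ?_ hm
    rw [Real.exp_neg, ← one_div]
    exact one_div_le_one_div_of_le (Real.exp_pos 1) (by linarith [Real.exp_one_lt_d9])
  have hL₃le : L₃ ≤ L₂ ^ 2 := by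
    have := Real.log_le_sub_one_of_pos hL₂0
    nlinarith
  calc 1 / L = 80 * L₂ ^ 2 / (L * L₃) * (L₃ / (80 * L₂ ^ 2)) := by
        field_simp
    _ ≤ 80 * L₂ ^ 2 / (L * L₃) * (1 / 3) := by
        refine mul_le_mul_of_nonneg_left ?_ (by positivity)
        rw [div_le_div_iff₀ (by positivity) (by norm_num)]
        nlinarith
    _ ≤ 80 * L₂ ^ 2 / (L * L₃) * Real.exp (-(1 / L₂)) :=
        mul_le_mul_of_nonneg_left hexp (by positivity)

/-- **`(log x/σ)^r ≤ x^{1/100}`**: the factor `σ^{-r}` costs only `x^{o(1)}` (used with the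
uniform bound `P(ñ_p = n) ≪ x^{-(1/3 + ε)}` toward (4.2)′ `P_q(p) ≤ x^{-3/5}` and toward the Markov
budgets of §6). [cite: FordGreenKonyaginMaynardTao2018, (6.12) p. 18 and §6 p. 19] -/
theorem log_div_sigma_pow_le : ∀ᶠ x : ℕ in atTop,
    (Real.log x / sigma x) ^ shiftCount x ≤ (x : ℝ) ^ ((1 : ℝ) / 100) := by
  filter_upwards [params_growth, inv_log_le_sigma] with x hg hσ
  obtain ⟨h1, h2, -, -, -, h200, -, -⟩ := hg
  have hL0 : 0 < Real.log x := by linarith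
  have hσ0 : 0 < sigma x := sigma_pos x
  have hx0 : (0 : ℝ) < x := by
    rcases Nat.eq_zero_or_pos x with hx | hx
    · subst hx; simp at h1; linarith
    · exact_mod_cast hx
  have hLσ : Real.log x / sigma x ≤ (Real.log x) ^ 2 := by
    rw [div_le_iff₀ hσ0]
    calc Real.log x = Real.log x * Real.log x * (1 / Real.log x) := by field_simp
      _ ≤ Real.log x * Real.log x * sigma x := mul_le_mul_of_nonneg_left hσ (by positivity)
      _ = (Real.log x) ^ 2 * sigma x := by ring
  have hr : (shiftCount x : ℝ) * Real.log (Real.log x) ≤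
      (Real.log x) ^ ((1 : ℝ) / 5) * Real.log (Real.log x) :=
    mul_le_mul_of_nonneg_right (shiftCount_le x) (by linarith)
  calc (Real.log x / sigma x) ^ shiftCount x ≤ ((Real.log x) ^ 2) ^ shiftCount x :=
        pow_le_pow_left₀ (div_nonneg hL0.le hσ0.le) hLσ _
    _ = Real.exp (2 * shiftCount x * Real.log (Real.log x)) := by
        rw [← Real.exp_log (pow_pos (pow_pos hL0 2) (shiftCount x)), Real.log_pow, Real.log_pow]
        congr 1
        push_cast
        ring
    _ ≤ Real.exp (Real.log x / 100) := Real.exp_le_exp.2 (by linarith)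
    _ = (x : ℝ) ^ ((1 : ℝ) / 100) := by
        rw [Real.rpow_def_of_pos hx0]
        congr 1
        ring

/-- **`log₂ x/10 ≤ log r ≤ log₂ x/5`** for `r = ⌊log^{1/5} x⌋` (so that `u ≍ log r ≍ log₂ x` in
`C = u x/(2σy)`). [cite: FordGreenKonyaginMaynardTao2018, (6.1) and the display after (6.10) p. 18] -/
theorem log_shiftCount_bounds : ∀ᶠ x : ℕ in atTop,
    Real.log (Real.log x) / 10 ≤ Real.log (shiftCount x) ∧
      Real.log (shiftCount x) ≤ Real.log (Real.log x) / 5 := by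
  filter_upwards [params_growth] with x hg
  obtain ⟨h1, -, -, -, -, -, h2r, h7⟩ := hg
  have hL0 : 0 < Real.log x := by linarith
  have hfl : (Real.log x) ^ ((1 : ℝ) / 5) < (shiftCount x : ℝ) + 1 := Nat.lt_floor_add_one _
  have hr0 : (0 : ℝ) < shiftCount x := by linarith
  have hlogr5 : Real.log ((Real.log x) ^ ((1 : ℝ) / 5)) = Real.log (Real.log x) / 5 := by
    rw [Real.log_rpow hL0]; ring
  constructor
  · have hhalf : (Real.log x) ^ ((1 : ℝ) / 5) / 2 ≤ shiftCount x := by linarith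
    have hlog2 := Real.log_two_lt_d9
    calc Real.log (Real.log x) / 10 ≤ Real.log (Real.log x) / 5 - Real.log 2 := by
          norm_num at hlog2 ⊢; linarith
      _ = Real.log ((Real.log x) ^ ((1 : ℝ) / 5) / 2) := by
          rw [Real.log_div (by linarith) (by norm_num), hlogr5]
      _ ≤ Real.log (shiftCount x) := Real.log_le_log (by linarith) hhalf
  · calc Real.log (shiftCount x) ≤ Real.log ((Real.log x) ^ ((1 : ℝ) / 5)) :=
          Real.log_le_log hr0 (shiftCount_le x)
      _ = Real.log (Real.log x) / 5 := hlogr5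

/-- **`x ≤ y`** for fixed `c > 0` and large `x` (`y = c x log x log₃ x/log₂ x`).
[cite: FordGreenKonyaginMaynardTao2018, (3.1)] -/
theorem le_ySieve {c : ℝ} (hc : 0 < c) : ∀ᶠ x : ℕ in atTop, (x : ℝ) ≤ ySieve c x := by
  have hℓ₂ : Tendsto (fun x : ℕ => Real.log (Real.log x)) atTop atTop :=
    Real.tendsto_log_atTop.comp (Real.tendsto_log_atTop.comp tendsto_natCast_atTop_atTop)
  filter_upwards [sigma_growth, hℓ₂.eventually_ge_atTop (1 / (81 * c))] with x hg hc'
  obtain ⟨h1, h2, h3, h4⟩ := hg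
  rw [ySieve, iter_two, iter_three]
  have hx0 : (0 : ℝ) ≤ x := Nat.cast_nonneg _
  have hL₂pos : 0 < Real.log (Real.log x) := by linarith
  have hone : 1 ≤ 81 * c * Real.log (Real.log x) := by
    rw [div_le_iff₀ (by positivity)] at hc'
    linarith
  have key : Real.log (Real.log x) ≤ c * (Real.log x * Real.log (Real.log (Real.log x))) := by
    calc Real.log (Real.log x) = Real.log (Real.log x) * 1 := (mul_one _).symm
      _ ≤ Real.log (Real.log x) * (81 * c * Real.log (Real.log x)) :=
          mul_le_mul_of_nonneg_left hone hL₂pos.le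
      _ = c * (81 * (Real.log (Real.log x)) ^ 2) := by ring
      _ ≤ c * Real.log x := mul_le_mul_of_nonneg_left h4 hc.le
      _ = c * (Real.log x * 1) := by ring
      _ ≤ c * (Real.log x * Real.log (Real.log (Real.log x))) :=
          mul_le_mul_of_nonneg_left (mul_le_mul_of_nonneg_left h3 (by linarith)) hc.le
  calc (x : ℝ) = x * Real.log (Real.log x) / Real.log (Real.log x) := by field_simp
    _ ≤ x * (c * (Real.log x * Real.log (Real.log (Real.log x)))) / Real.log (Real.log x) := by
        gcongr
    _ = c * (x * Real.log x * Real.log (Real.log (Real.log x)) / Real.log (Real.log x)) := by ring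

/-- `y → ∞` with `x` (fixed `c > 0`). [cite: FordGreenKonyaginMaynardTao2018, (3.1)] -/
theorem tendsto_ySieve {c : ℝ} (hc : 0 < c) : Tendsto (fun x : ℕ => ySieve c x) atTop atTop :=
  tendsto_atTop_mono' atTop (le_ySieve hc) tendsto_natCast_atTop_atTop

/-- **`y ≤ x²`** uniformly in `0 < c ≤ 1`, for large `x`. [cite: FordGreenKonyaginMaynardTao2018, (3.1)] -/
theorem ySieve_le_sq : ∀ᶠ x : ℕ in atTop, ∀ c : ℝ, 0 < c → c ≤ 1 → ySieve c x ≤ (x : ℝ) ^ 2 := by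
  filter_upwards [params_growth] with x hg c hc hc1
  obtain ⟨h1, h2, h3, -, hsq, -⟩ := hg
  rw [ySieve, iter_two, iter_three]
  have hx0 : (0 : ℝ) ≤ x := Nat.cast_nonneg _
  have hL₂pos : 0 < Real.log (Real.log x) := by linarith
  have hL₃le : Real.log (Real.log (Real.log x)) ≤ Real.log (Real.log x) := by
    have := Real.log_le_sub_one_of_pos hL₂pos; linarith
  have hL₂le : Real.log (Real.log x) ≤ Real.log x := by
    have := Real.log_le_sub_one_of_pos (show 0 < Real.log x by linarith); linarith
  have hin : (x : ℝ) * Real.log x * Real.log (Real.log (Real.log x)) / Real.log (Real.log x) ≤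
      (x : ℝ) ^ 2 := by
    rw [div_le_iff₀ hL₂pos]
    calc (x : ℝ) * Real.log x * Real.log (Real.log (Real.log x))
          ≤ (x : ℝ) * Real.log x * Real.log (Real.log x) :=
            mul_le_mul_of_nonneg_left hL₃le (by positivity)
      _ ≤ (x : ℝ) * Real.log x * Real.log x :=
            mul_le_mul_of_nonneg_left hL₂le (by positivity)
      _ = x * (Real.log x) ^ 2 := by ring
      _ ≤ x * x := mul_le_mul_of_nonneg_left hsq hx0
      _ = (x : ℝ) ^ 2 * 1 := by ring
      _ ≤ (x : ℝ) ^ 2 * Real.log (Real.log x) :=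
            mul_le_mul_of_nonneg_left h2 (by positivity)
  calc c * ((x : ℝ) * Real.log x * Real.log (Real.log (Real.log x)) / Real.log (Real.log x))
        ≤ 1 * ((x : ℝ) * Real.log x * Real.log (Real.log (Real.log x)) / Real.log (Real.log x)) :=
          mul_le_mul_of_nonneg_right hc1 (by positivity)
    _ ≤ (x : ℝ) ^ 2 := by rw [one_mul]; exact hin

/-- **Diameter bounds `M = x³`** for Lemma 6.1 in §6: `2y + 2r²x ≤ x³` and `4r²x ≤ x³`
(uniformly in `0 < c ≤ 1`, large `x`). [cite: FordGreenKonyaginMaynardTao2018, Lemma 6.1 p. 17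
(«`B ≪ x²`»), Lemma 6.2 (proof) p. 19] -/
theorem diam_le_cube : ∀ᶠ x : ℕ in atTop, ∀ c : ℝ, 0 < c → c ≤ 1 →
    2 * ySieve c x + 2 * (shiftCount x : ℝ) ^ 2 * x ≤ (x : ℝ) ^ 3 ∧
      4 * (shiftCount x : ℝ) ^ 2 * x ≤ (x : ℝ) ^ 3 := by
  filter_upwards [params_growth, ySieve_le_sq] with x hg hy c hc hc1
  obtain ⟨h1, -, -, -, hsq, -⟩ := hg
  have hx0 : (0 : ℝ) ≤ x := Nat.cast_nonneg _
  have hr2 : (shiftCount x : ℝ) ^ 2 ≤ x :=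
    (shiftCount_sq_le (by linarith)).trans (le_trans (by nlinarith) hsq)
  have hx4 : (4 : ℝ) ≤ x := le_trans (by nlinarith) hsq
  have hyx := hy c hc hc1
  have hcube : 4 * (x : ℝ) ^ 2 ≤ (x : ℝ) ^ 3 := by nlinarith
  constructor
  · nlinarith [mul_le_mul_of_nonneg_right hr2 hx0]
  · nlinarith [mul_le_mul_of_nonneg_right hr2 hx0]

/-- `|𝒬| ≤ π(⌊y⌋)`. [cite: FordGreenKonyaginMaynardTao2018, (3.5)] -/
theorem card_primesQ_le_primeCounting (c : ℝ) (x : ℕ) :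
    #(primesQ c x) ≤ Nat.primeCounting ⌊ySieve c x⌋₊ := by
  rw [← Nat.primesLE_card_eq_primeCounting]
  refine Finset.card_le_card fun q hq => ?_
  simp only [primesQ, Finset.mem_filter, Finset.mem_Icc] at hq
  exact Nat.mem_primesLE.2 ⟨hq.1.2, hq.2⟩

/-- The prime number theorem (tree: `LFunctions.primeCounting_isEquivalent_holds`) as a two-sided
bound. [folklore] -/
private theorem eventually_abs_primeCounting_sub_le {κ : ℝ} (hκ : 0 < κ) :
    ∀ᶠ t : ℝ in atTop,
      |(Nat.primeCounting ⌊t⌋₊ : ℝ) - t / Real.log t| ≤ κ * (t / Real.log t) := by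
  have h0 : (fun t : ℝ ↦ (Nat.primeCounting ⌊t⌋₊ : ℝ)) ~[atTop] fun t ↦ t / Real.log t :=
    Literature.NumberTheory.LFunctions.primeCounting_isEquivalent_holds
  filter_upwards [h0.isLittleO.bound hκ, eventually_ge_atTop (1 : ℝ)] with t ht ht1
  have ht0 : 0 ≤ t := by linarith
  have hl0 : 0 ≤ Real.log t := Real.log_nonneg ht1
  have hnn : 0 ≤ t / Real.log t := div_nonneg ht0 hl0
  simpa [Real.norm_eq_abs, abs_div, abs_of_nonneg hnn, abs_of_nonneg ht0, abs_of_nonneg hl0]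
    using ht

/-- **`|𝒬| ≤ 1.01 y/log x`** for fixed `c > 0` and large `x` (prime number theorem; with (6.9)
this gives `σ|𝒬| ≤ 81 c x log₂ x/log x`, the main term of (4.5)).
[cite: FordGreenKonyaginMaynardTao2018, (4.11) p. 14 and (6.9) p. 17] -/
theorem card_primesQ_le {c : ℝ} (hc : 0 < c) : ∀ᶠ x : ℕ in atTop,
    (#(primesQ c x) : ℝ) ≤ 101 / 100 * ySieve c x / Real.log x := by
  filter_upwards [(tendsto_ySieve hc).eventually
      (eventually_abs_primeCounting_sub_le (show (0 : ℝ) < 1 / 100 by norm_num)),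
    le_ySieve hc, params_growth] with x hpnt hxy hg
  obtain ⟨h1, -⟩ := hg
  have hx0 : (0 : ℝ) < x := by
    rcases Nat.eq_zero_or_pos x with hx | hx
    · subst hx; simp at h1; linarith
    · exact_mod_cast hx
  have hy0 : 0 < ySieve c x := lt_of_lt_of_le hx0 hxy
  have hlog : Real.log x ≤ Real.log (ySieve c x) := Real.log_le_log hx0 hxy
  have hL0 : 0 < Real.log x := by linarith
  have h1' := card_primesQ_le_primeCounting c x
  have h2' : (Nat.primeCounting ⌊ySieve c x⌋₊ : ℝ) ≤
      (1 + 1 / 100) * (ySieve c x / Real.log (ySieve c x)) := by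
    have := (abs_le.1 hpnt).2; linarith
  calc (#(primesQ c x) : ℝ) ≤ Nat.primeCounting ⌊ySieve c x⌋₊ := by exact_mod_cast h1'
    _ ≤ (1 + 1 / 100) * (ySieve c x / Real.log (ySieve c x)) := h2'
    _ ≤ (1 + 1 / 100) * (ySieve c x / Real.log x) :=
        mul_le_mul_of_nonneg_left (div_le_div_of_nonneg_left hy0.le hL0 hlog) (by norm_num)
    _ = 101 / 100 * ySieve c x / Real.log x := by ring

end FGKMT2018

end Literature.NumberTheory.Sieve
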